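import Mathlib
import HarnessLib
import Summits.Ventures.LatticeQCDFlow.Exactness.IMHModeRateSharp

/-!
# Exactness — the exact worst-case mixing profile of an independence sampler with an atom-free mode, and the
# resulting mixing-time window `(1 − ε)·w(x₀) ≤ t_mix(ε) ≤ log(1/ε)·w(x₀) + 1`

HONEST FRAMING: exact (Metropolis-corrected) sampling algorithms for lattice gauge theory;
figures of merit are autocorrelation/cost numbers at stated couplings and volumes; no
continuum-physics claim.

Venture `LatticeQCDFlow` (cell pub-lqcd), topic `Exactness`, FANOUT row 30 (lean-1, GEN-28) — OUR WORK, the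
abstract layer under `Scaling/AutoregressiveGaugeMixingProfile`.  Setting of `IMHModeRateSharp`: an independence
Metropolis sampler `K = indepMH q w` with normalised weight `w > 0` (`π = w·q` a probability law) and a mode `x₀`
(`w ≤ w(x₀)`); `A(x₀) = 1/w(x₀)` is the acceptance mass at the mode.

* `one_sub_pow_le_of_log_le`, `lt_one_sub_pow_of_mul_lt` — the two real inequalities behind every window
  statement: `(1 − A)^t ≤ ε` once `t·A ≥ log(1/ε)` (`1 − A ≤ e^{−A}`), and `ε < (1 − A)^t` while `t·A < 1 − ε`
  (Bernoulli);
* **`indepMH_worstCase_le_iff`** — atom-free mode (`q{x₀} = 0`): at time `t`, every start and every event are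
  `ε`-close to `π` IFF `(1 − 1/w(x₀))^t ≤ ε` (the profile of `IMHModeRateSharp`, read as an iff);
* **`indepMH_mixed_of_log_le`** — (any mode) `t/w(x₀) ≥ log(1/ε)`, `ε > 0` ⟹ `ε`-mixed from every start;
* **`indepMH_not_mixed_of_mul_lt`** — (atom-free mode) `t/w(x₀) < 1 − ε` ⟹ not `ε`-mixed from every start.

No `def`, no `sorry`, nothing cited as a fact; general measurable space with measurable singletons.
-/

noncomputable section

namespace Summit.Ventures.LatticeQCDFlow.Exactness

open MeasureTheory ProbabilityTheory Function
open scoped ENNReal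

/-- **`(1 − A)^t ≤ ε` once `t·A ≥ log(1/ε)`** (`ε > 0`, `A ≤ 1`; via `1 − A ≤ e^{−A}`). [ours] -/
theorem one_sub_pow_le_of_log_le {A ε : ℝ} (hε : 0 < ε) (hA : A ≤ 1) {n : ℕ}
    (hn : Real.log (1 / ε) ≤ n * A) : (1 - A) ^ n ≤ ε := by
  have h1 : 1 - A ≤ Real.exp (-A) := by linarith [Real.add_one_le_exp (-A)]
  rw [one_div, Real.log_inv] at hn
  calc (1 - A) ^ n ≤ Real.exp (-A) ^ n := pow_le_pow_left₀ (sub_nonneg.2 hA) h1 n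
    _ = Real.exp (-(n * A)) := by rw [← Real.exp_nat_mul, mul_neg]
    _ ≤ ε := by
      rw [← Real.le_log_iff_exp_le hε]
      linarith

/-- **`ε < (1 − A)^t` while `t·A < 1 − ε`** (`A ≤ 2`; Bernoulli's inequality). [ours] -/
theorem lt_one_sub_pow_of_mul_lt {A ε : ℝ} (hA : A ≤ 2) {n : ℕ} (hn : n * A < 1 - ε) :
    ε < (1 - A) ^ n := by
  have hB := one_add_mul_le_pow (show (-2 : ℝ) ≤ -A by linarith) n
  have h1 : (1 : ℝ) + -A = 1 - A := by ring
  rw [h1] at hB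
  linarith

variable {Ω : Type*} [MeasurableSpace Ω] [MeasurableSingletonClass Ω]
variable {q : Measure Ω} [IsProbabilityMeasure q] {w : Ω → ℝ}

/-- **THE EXACT WORST-CASE PROFILE AS AN IFF** (atom-free mode): at time `t`, every start and every event are
`ε`-close to `π = w·q` iff `(1 − 1/w(x₀))^t ≤ ε`. [ours] -/
theorem indepMH_worstCase_le_iff (hw : Measurable w) (hw0 : ∀ y, 0 < w y) {x₀ : Ω}
    (hmax : ∀ y, w y ≤ w x₀) (hqx : q {x₀} = 0)
    [IsProbabilityMeasure (q.withDensity fun y => ENNReal.ofReal (w y))] (t : ℕ) (ε : ℝ) :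
    (∀ (μ : Measure Ω) [IsProbabilityMeasure μ] (A : Set Ω),
      |((fun m : Measure Ω => m.bind (indepMH q w))^[t] μ).real A -
        (q.withDensity fun y => ENNReal.ofReal (w y)).real A| ≤ ε) ↔ (1 - (w x₀)⁻¹) ^ t ≤ ε := by
  obtain ⟨hall, hatt⟩ := indepMH_uniform_rate_sharp hw hw0 hmax hqx t
  constructor
  · intro h
    rw [← hatt]
    exact h (Measure.dirac x₀) {x₀}
  · intro h μ _ A
    exact (hall μ A).trans h

omit [MeasurableSingletonClass Ω] in
/-- **UPPER WINDOW EDGE** (any mode): if `t/w(x₀) ≥ log(1/ε)` (`ε > 0`), then at time `t` every start and every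
event are `ε`-close to `π`. [ours] -/
theorem indepMH_mixed_of_log_le (hw : Measurable w) (hw0 : ∀ y, 0 < w y) {x₀ : Ω}
    (hmax : ∀ y, w y ≤ w x₀) [IsProbabilityMeasure (q.withDensity fun y => ENNReal.ofReal (w y))]
    {ε : ℝ} (hε : 0 < ε) {t : ℕ} (ht : Real.log (1 / ε) ≤ t * (w x₀)⁻¹)
    (μ : Measure Ω) [IsProbabilityMeasure μ] (A : Set Ω) :
    |((fun m : Measure Ω => m.bind (indepMH q w))^[t] μ).real A -
        (q.withDensity fun y => ENNReal.ofReal (w y)).real A| ≤ ε :=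
  (indepMH_uniform_rate_of_mode hw hw0 hmax μ t A).trans
    (one_sub_pow_le_of_log_le hε (inv_le_one_of_one_le₀ (one_le_of_mode (q := q) hmax)) ht)

/-- **LOWER WINDOW EDGE** (atom-free mode): if `t/w(x₀) < 1 − ε`, then at time `t` NOT every start and event
are `ε`-close to `π` (the start `δ_{x₀}` on `{x₀}` deviates by more than `ε`). [ours] -/
theorem indepMH_not_mixed_of_mul_lt (hw : Measurable w) (hw0 : ∀ y, 0 < w y) {x₀ : Ω}
    (hmax : ∀ y, w y ≤ w x₀) (hqx : q {x₀} = 0)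
    [IsProbabilityMeasure (q.withDensity fun y => ENNReal.ofReal (w y))] {ε : ℝ} {t : ℕ}
    (ht : t * (w x₀)⁻¹ < 1 - ε) :
    ¬ ∀ (μ : Measure Ω) [IsProbabilityMeasure μ] (A : Set Ω),
      |((fun m : Measure Ω => m.bind (indepMH q w))^[t] μ).real A -
        (q.withDensity fun y => ENNReal.ofReal (w y)).real A| ≤ ε := by
  intro h
  have h1 := (indepMH_worstCase_le_iff hw hw0 hmax hqx t ε).1 h
  have hA : (w x₀)⁻¹ ≤ 2 := (inv_le_one_of_one_le₀ (one_le_of_mode (q := q) hmax)).trans one_le_two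
  exact absurd h1 (not_le.2 (lt_one_sub_pow_of_mul_lt hA ht))

end Summit.Ventures.LatticeQCDFlow.Exactness

end
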